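import Summits.ValiantsHypothesis.ValiantsHypothesis.Theorems.LacunarySymmetroidMatrixDescartesCensusDoorA34SheetWindowOrderedMiddle

/-!
# `MatrixDescartes` census — DOOR A at `(3,4)`: window-ordered supports in the chamber `3·d₁ < 2·d₀ + d₂` — the PAIR LAW at the bottom: a null-top eighteen
# cannot have `S₀` and `S₁` DEFINITE OF THE SAME SIGN (any cell of the top letter)

HONEST FRAMING.  Object-search cell `pub-symmetroid`, engine seat `val-sym-eng-2` (g4); helper row beside the registered strata line
`Cruxes/DoorA34/Lines/strata.lean` on stmt-ValiantsHypothesis-19980 (`DoorA34 = PosRootLawAt 3 4 18`: OPEN, typed, never asserted here).  Companion of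
…SheetWindowOrdered / …Semidef / …Middle.  In the chamber `3d₁ < 2d₀ + d₂` of a window-ordered support the FOUR SMALLEST sheet exponents are
`3d₀ < 2d₀+d₁ < d₀+2d₁ < 3d₁` (ranks `0,1,2,3`: `sheetRank_bottom` / `sheetRank_subBottom` / `sheetRank_lowPair` / `sheetRank_coreMiddle_of_chamber`), so the
edge `{0,1}` of a null-top eighteen has `V₀₁ = 1+1+1 = 3` sign changes, and door-p3's PAIR LAW on the sheet (`Census.definite_pair_count_sheet`) forbids two
definite letters `S₀, S₁` of the SAME sign:

* `sym_sum_lt_lowPair` / `sym_sum_ge_lowPair` (slots below `d₀ + 2d₁` are `{0,0,0}, {0,0,1}`), `sheetRank_subBottom_of_nullTop_eighteen` (`ρ(2d₀+d₁) = 1`),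
  `sheetRank_lowPair_of_chamber` (`ρ(d₀+2d₁) = 2`);
* **`card_posRoots_le_17_of_windowOrdered_chamber_sameSignBottomPair`** — `StrictMono d`, `3·d 2 < d 3`, `3·d 1 < 2·d 0 + d 2`, `det S₃ = 0`, `S₀, S₁` both
  positive definite or both negative definite ⇒ `Z₊ ≤ 17`.

Nothing here bounds anything else; `DoorA34` and the three stubs stay OPEN; registers unchanged; nothing on `MatrixDescartes` (stmt-ValiantsHypothesis-18050) or
`VP ≠ VNP` — VP≠VNP not moved.  [folklore] Descartes (sharp case) bookkeeping + door-p3's pair law; elementary.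
-/

-- `Summit.ValiantsHypothesis.ValiantsHypothesis.…` repeats a component by the D-0017 layout
-- (single-conjunct summit), which the `dupNamespace` linter flags; the name is mandated.
set_option linter.dupNamespace false

namespace Summit.ValiantsHypothesis.ValiantsHypothesis.Theorems.LacunarySymmetroidMatrixDescartes.Census

open Polynomial Finset Matrix
open scoped BigOperators Polynomial Matrix

/-- Slots below `d₀ + 2d₁`: no `3`, no `2`, at most one `1`. [folklore] -/
theorem sym_sum_lt_lowPair (d : Fin 4 → ℕ) (hd : StrictMono d) (s : Sym (Fin 4) 3) (h3 : (3 : Fin 4) ∉ (s : Multiset (Fin 4)))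
    (h2 : (2 : Fin 4) ∉ (s : Multiset (Fin 4))) (h1 : Multiset.count (1 : Fin 4) (s : Multiset (Fin 4)) ≤ 1) :
    ((s : Multiset (Fin 4)).map d).sum < d 0 + 2 * d 1 := by
  have h01 : d 0 < d 1 := hd (by decide)
  have hle0 : ∀ l : Fin 4, l ≠ 3 → l ≠ 2 → l ≠ 1 → d l ≤ d 0 := fun l hl3 hl2 hl1 => by
    have : (l : ℕ) ≠ 3 := fun h => hl3 (Fin.ext h)
    have : (l : ℕ) ≠ 2 := fun h => hl2 (Fin.ext h)
    have : (l : ℕ) ≠ 1 := fun h => hl1 (Fin.ext h)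
    have hl0 : l = 0 := Fin.ext (by have := l.2; show (l : ℕ) = 0; omega)
    rw [hl0]
  have hcs : Multiset.card (s : Multiset (Fin 4)) = 3 := Sym.card_coe
  by_cases hmem : (1 : Fin 4) ∈ (s : Multiset (Fin 4))
  · obtain ⟨t, ht⟩ := Multiset.exists_cons_of_mem hmem
    have hct : Multiset.card t = 2 := by rw [ht, Multiset.card_cons] at hcs; omega
    have h1t : (1 : Fin 4) ∉ t := by
      intro h1t
      rw [ht, Multiset.count_cons_self] at h1
      have := Multiset.count_pos.mpr h1t
      omega
    have h3t : (3 : Fin 4) ∉ t := fun h => h3 (by rw [ht]; exact Multiset.mem_cons_of_mem h)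
    have h2t : (2 : Fin 4) ∉ t := fun h => h2 (by rw [ht]; exact Multiset.mem_cons_of_mem h)
    have hsum : (t.map d).sum ≤ 2 * d 0 := by
      have h := Multiset.sum_le_card_nsmul (t.map d) (d 0) (by
        intro x hx
        obtain ⟨l, hl, rfl⟩ := Multiset.mem_map.mp hx
        exact hle0 l (fun h => h3t (h ▸ hl)) (fun h => h2t (h ▸ hl)) (fun h => h1t (h ▸ hl)))
      simpa [hct] using h
    rw [ht, Multiset.map_cons, Multiset.sum_cons]; omega
  · have hsum : ((s : Multiset (Fin 4)).map d).sum ≤ 3 * d 0 := by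
      have h := Multiset.sum_le_card_nsmul ((s : Multiset (Fin 4)).map d) (d 0) (by
        intro x hx
        obtain ⟨l, hl, rfl⟩ := Multiset.mem_map.mp hx
        exact hle0 l (fun h => h3 (h ▸ hl)) (fun h => h2 (h ▸ hl)) (fun h => hmem (h ▸ hl)))
      simpa [hcs] using h
    omega

/-- Conversely: a `3`, a `2`, or two `1`s give exponent `≥ d₀ + 2d₁` (chamber `3d₁ < 2d₀ + d₂`, window-ordered). [folklore] -/
theorem sym_sum_ge_lowPair (d : Fin 4 → ℕ) (hd : StrictMono d) (hwin : 3 * d 2 < d 3) (hch : 3 * d 1 < 2 * d 0 + d 2) (s : Sym (Fin 4) 3)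
    (h : (3 : Fin 4) ∈ (s : Multiset (Fin 4)) ∨ (2 : Fin 4) ∈ (s : Multiset (Fin 4)) ∨ 2 ≤ Multiset.count (1 : Fin 4) (s : Multiset (Fin 4))) :
    d 0 + 2 * d 1 ≤ ((s : Multiset (Fin 4)).map d).sum := by
  have h01 : d 0 < d 1 := hd (by decide)
  have hle0 : ∀ l : Fin 4, d 0 ≤ d l := fun l => hd.monotone (Fin.zero_le l)
  rcases h with h | h | h
  · have := sym_sum_ge_three_d1 d hd hwin hch s (Or.inl h); omega
  · have := sym_sum_ge_three_d1 d hd hwin hch s (Or.inr (Or.inl h)); omega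
  · have h1mem : (1 : Fin 4) ∈ (s : Multiset (Fin 4)) := Multiset.count_pos.mp (by omega)
    obtain ⟨t, ht⟩ := Multiset.exists_cons_of_mem h1mem
    have hct1 : 1 ≤ Multiset.count (1 : Fin 4) t := by rw [ht, Multiset.count_cons_self] at h; omega
    have h1t : (1 : Fin 4) ∈ t := Multiset.count_pos.mp (by omega)
    obtain ⟨u, hu⟩ := Multiset.exists_cons_of_mem h1t
    have hcu : Multiset.card u = 1 := by
      have hcs : Multiset.card (s : Multiset (Fin 4)) = 3 := Sym.card_coe
      rw [ht, Multiset.card_cons, hu, Multiset.card_cons] at hcs; omega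
    have hu0 : d 0 ≤ (u.map d).sum := by
      have h := Multiset.card_nsmul_le_sum (s := u.map d) (a := d 0) (by
        intro x hx; obtain ⟨l, -, rfl⟩ := Multiset.mem_map.mp hx; exact hle0 l)
      simpa [hcu] using h
    rw [ht, hu, Multiset.map_cons, Multiset.sum_cons, Multiset.map_cons, Multiset.sum_cons]; omega

/-- The slots below `d₀ + 2d₁`: `2` of them. [folklore] -/
theorem card_slots_below_lowPair :
    (((Finset.univ : Finset (Sym (Fin 4) 3)).erase (Sym.replicate 3 3)).filter
      (fun s : Sym (Fin 4) 3 => (3 : Fin 4) ∉ (s : Multiset (Fin 4)) ∧ (2 : Fin 4) ∉ (s : Multiset (Fin 4)) ∧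
        Multiset.count (1 : Fin 4) (s : Multiset (Fin 4)) ≤ 1)).card = 2 := by
  decide

/-- **`ρ(d₀ + 2d₁) = 2`** in the chamber (null-top eighteen). [folklore] -/
theorem sheetRank_lowPair_of_chamber (d : Fin 4 → ℕ) (hd : StrictMono d) (hwin : 3 * d 2 < d 3) (hch : 3 * d 1 < 2 * d 0 + d 2)
    (S : Fin 4 → Matrix (Fin 3) (Fin 3) ℝ) (h3 : (S 3).det = 0)
    (h18 : 18 ≤ ((Matrix.det (∑ l, ((X : ℝ[X]) ^ d l) • (S l).map C)).roots.toFinset.filter (fun t => 0 < t)).card) :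
    ((Matrix.det (∑ l, ((X : ℝ[X]) ^ d l) • (S l).map C)).support.filter (· < d 0 + 2 * d 1)).card = 2 := by
  classical
  have hinj := sym_sum_injOn_of_nullTop_eighteen d S h3 h18
  set E := (Finset.univ : Finset (Sym (Fin 4) 3)).erase (Sym.replicate 3 3) with hE
  set σ : Sym (Fin 4) 3 → ℕ := fun s => ((s : Multiset (Fin 4)).map d).sum with hσ
  have hfilt : (Matrix.det (∑ l, ((X : ℝ[X]) ^ d l) • (S l).map C)).support.filter (· < d 0 + 2 * d 1)
      = (E.filter (fun s : Sym (Fin 4) 3 => (3 : Fin 4) ∉ (s : Multiset (Fin 4)) ∧ (2 : Fin 4) ∉ (s : Multiset (Fin 4)) ∧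
          Multiset.count (1 : Fin 4) (s : Multiset (Fin 4)) ≤ 1)).image σ := by
    rw [support_det_pencil_eq_of_nullTop_eighteen d S h3 h18]
    ext c
    simp only [Finset.mem_filter, Finset.mem_image]
    constructor
    · rintro ⟨⟨s, hs, rfl⟩, hlt⟩
      refine ⟨s, ⟨hs, ?_, ?_, ?_⟩, rfl⟩
      · intro hmem; exact absurd hlt (not_lt.mpr (sym_sum_ge_lowPair d hd hwin hch s (Or.inl hmem)))
      · intro hmem; exact absurd hlt (not_lt.mpr (sym_sum_ge_lowPair d hd hwin hch s (Or.inr (Or.inl hmem))))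
      · by_contra hc; exact absurd hlt (not_lt.mpr (sym_sum_ge_lowPair d hd hwin hch s (Or.inr (Or.inr (by omega)))))
    · rintro ⟨s, ⟨hs, hn3, hn2, hc⟩, rfl⟩
      exact ⟨⟨s, hs, rfl⟩, sym_sum_lt_lowPair d hd s hn3 hn2 hc⟩
  rw [hfilt, Finset.card_image_of_injOn (hinj.mono (by intro s hs; exact (Finset.mem_filter.mp hs).1))]
  exact card_slots_below_lowPair

/-- **`ρ(2d₀ + d₁) = 1`** on any sorted support (null-top eighteen): only the bottom cube lies below. [folklore] -/
theorem sheetRank_subBottom_of_nullTop_eighteen (d : Fin 4 → ℕ) (hd : StrictMono d) (S : Fin 4 → Matrix (Fin 3) (Fin 3) ℝ) (h3 : (S 3).det = 0)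
    (h18 : 18 ≤ ((Matrix.det (∑ l, ((X : ℝ[X]) ^ d l) • (S l).map C)).roots.toFinset.filter (fun t => 0 < t)).card) :
    ((Matrix.det (∑ l, ((X : ℝ[X]) ^ d l) • (S l).map C)).support.filter (· < 2 * d 0 + d 1)).card = 1 := by
  classical
  have h001 : Multiset.card ({0, 0, 1} : Multiset (Fin 4)) = 3 := by simp
  set P := Matrix.det (∑ l, ((X : ℝ[X]) ^ d l) • (S l).map C) with hP
  have hsupp := support_det_pencil_eq_of_nullTop_eighteen d S h3 h18
  have hr0 : Sym.replicate 3 (0 : Fin 4) ≠ Sym.replicate 3 3 := by decide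
  have hmem0 : 3 * d 0 ∈ P.support := by
    rw [hP, hsupp]
    refine Finset.mem_image.mpr ⟨Sym.replicate 3 0, Finset.mem_erase.mpr ⟨hr0, Finset.mem_univ _⟩, ?_⟩
    simp only [Sym.coe_replicate, Multiset.map_replicate, Multiset.sum_replicate, smul_eq_mul]
  have h01 : d 0 < d 1 := hd (by decide)
  have hfilt : P.support.filter (fun c => c < 2 * d 0 + d 1) = {3 * d 0} := by
    ext c
    simp only [Finset.mem_filter, Finset.mem_singleton]
    constructor
    · rintro ⟨hc, hlt⟩
      rw [hP, hsupp] at hc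
      obtain ⟨s, hs, rfl⟩ := Finset.mem_image.mp hc
      by_cases hs0 : s = Sym.replicate 3 0
      · subst hs0; simp only [Sym.coe_replicate, Multiset.map_replicate, Multiset.sum_replicate, smul_eq_mul]
      by_cases hs1 : s = (⟨{0, 0, 1}, h001⟩ : Sym (Fin 4) 3)
      · subst hs1; exact absurd ((sym_sum_001 d h001).symm.trans_lt hlt |> fun h => h) (lt_irrefl _)
      · have := subbottom_lt_sym_sum_of_strictMono d hd s hs0 (fun h => hs1 (Subtype.ext h))
        omega
    · rintro rfl
      exact ⟨hmem0, by omega⟩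
  rw [hfilt, Finset.card_singleton]

/-- **PAIR LAW AT THE BOTTOM (chamber `3d₁ < 2d₀ + d₂`, window-ordered).**  A pencil with `det S₃ = 0` whose letters `S₀, S₁` are both positive definite, or
both negative definite, has at most `17` distinct positive roots. [folklore] -/
theorem card_posRoots_le_17_of_windowOrdered_chamber_sameSignBottomPair (d : Fin 4 → ℕ) (hd : StrictMono d) (hwin : 3 * d 2 < d 3)
    (hch : 3 * d 1 < 2 * d 0 + d 2) (S : Fin 4 → Matrix (Fin 3) (Fin 3) ℝ) (h3 : (S 3).det = 0)
    (hsame : ((S 0).PosDef ∧ (S 1).PosDef) ∨ ((-S 0).PosDef ∧ (-S 1).PosDef)) :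
    ((Matrix.det (∑ l, ((X : ℝ[X]) ^ d l) • (S l).map C)).roots.toFinset.filter (fun t => 0 < t)).card ≤ 17 := by
  by_contra hlt
  have h18 : 18 ≤ ((Matrix.det (∑ l, ((X : ℝ[X]) ^ d l) • (S l).map C)).roots.toFinset.filter (fun t => 0 < t)).card := by omega
  set ρ : ℕ → ℕ := fun e => ((Matrix.det (∑ l, ((X : ℝ[X]) ^ d l) • (S l).map C)).support.filter (· < e)).card with hρ
  have hx : (S 0).PosDef ∨ (-S 0).PosDef := by rcases hsame with ⟨h, _⟩ | ⟨h, _⟩; exacts [Or.inl h, Or.inr h]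
  have hy : (S 1).PosDef ∨ (-S 1).PosDef := by rcases hsame with ⟨_, h⟩ | ⟨_, h⟩; exacts [Or.inl h, Or.inr h]
  obtain ⟨hsame', -⟩ := definite_pair_count_sheet d hd S h3 (by decide : (0 : Fin 4) ≠ 1) (by decide) (by decide) hx hy h18 ρ
    (fun e => rfl)
  have hiff : (S 0).PosDef ↔ (S 1).PosDef := by
    rcases hsame with ⟨h0, h1⟩ | ⟨h0, h1⟩
    · exact iff_of_true h0 h1
    · exact iff_of_false (not_posDef_of_neg_posDef h0) (not_posDef_of_neg_posDef h1)
  have w := hsame' hiff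
  have r0 : ρ (3 * d 0) = 0 := sheetRank_bottom_of_nullTop_eighteen d hd S h3 h18
  have r1 : ρ (2 * d 0 + d 1) = 1 := sheetRank_subBottom_of_nullTop_eighteen d hd S h3 h18
  have r2 : ρ (2 * d 1 + d 0) = 2 := by
    rw [show 2 * d 1 + d 0 = d 0 + 2 * d 1 by ring]; exact sheetRank_lowPair_of_chamber d hd hwin hch S h3 h18
  have r3 : ρ (3 * d 1) = 3 := sheetRank_coreMiddle_of_chamber d hd hwin hch S h3 h18
  rw [r0, r1, r2, r3] at w
  norm_num at w

end Summit.ValiantsHypothesis.ValiantsHypothesis.Theorems.LacunarySymmetroidMatrixDescartes.Census
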